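import Summits.Ventures.Crystal3D.Theorems.StickyWulffConstantNoReconstructionGainLineCount
import Summits.Ventures.Crystal3D.Theorems.StickyWulffConstantNoReconstructionGainFccShell
import Summits.Ventures.Crystal3D.StickySpheres.FccShadowBound
import Summits.Ventures.Crystal3D.StickySpheres.FinsetBridge
import HarnessLib

/-!
# `stub_sampleDeficit`: the slab sample's own deficiency counts its two flat faces

HONEST FRAMING. Part of the venture `Summits/Ventures/Crystal3D` (cell `crystal3d-full`).
Registered stub `stub_sampleDeficit` of the line `adhesion` for the crux `NoReconstructionGain`
(stmt-Ventures-19144, `route-Ventures-StickyWulffConstant`): with `X ⊇ P` a unit packing containing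
the slab sample `P = Λ₀ ∩ {−2R ≤ ⟪p,ν⟫ ≤ −R, ‖p‖² − ⟪p,ν⟫² ≤ ρ²}` (`Λ₀ = fccStacking 1 √(2/3)`) and
`Q = X \ P`, the deficiency splits as `D(X) = D(P) + D(Q) − #cross(P,Q)`; this file proves the
ON-LATTICE half

  `D(P) ≥ 2 φ(ν) π ρ² − C ρ`,  `C = 60 √2 π`, for EVERY unit normal `ν`, every `1 ≤ R ≤ ρ`,

with the crux's inlined `φ(ν) = (√2/4) ∑ᶠ_{w ∈ Λ₀, ‖w‖ = 1} |⟪w, ν⟫|`.  Proof = the cell's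
P1-SPEC-A recipe (HOME/eng/MEMO-3.md ADDENDUM K) with a constant uniform in `ν`:
(L1) run counting — `D(P) ≥` the number of bond lines of the six `⟨110⟩` classes meeting `P`
(`numContacts_add_sum_card_dropCoord_le`, `FccShadowBound`); (L2)+(L3) each class `W` contributes
`≥ √2 |⟪W,ν⟫| π ρ² − 10 √2 π ρ` lines (`sqrt_two_mul_abs_inner_mul_pi_mul_sq_le_card`,
`…NoReconstructionGainLineCount`: mid-plane transversals, plane coordinates, shear identity, affine
disc count); (L4) `∑_{6 classes} √2 |⟪W,ν⟫| = 2 φ(ν)` (`finsum_fccShell_abs_inner`,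
`…NoReconstructionGainFccShell`).

WHAT THIS IS NOT: the atom `stub_adhesion` (adhesion ≤ cohesive deficiency for the off-lattice rest
`Q`) is untouched, so the crux is NOT proved here; rung F-C1 not moved.
-/

noncomputable section

namespace Summit.Ventures.Crystal3D.Theorems

open Summit.Ventures.Crystal3D Finset Matrix
open Literature.Probability.LatticeModels (Site dropCoord mem_dropCoord_iff)
open Literature.MathematicalPhysics.StatisticalMechanics (barlowPos barlowStacking fccStacking
  constHagg haggLabel_const isHaggSeq_const barlowPos_mem contactDeficiency
  le_dist_of_mem_barlowStacking_ideal)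
open scoped InnerProductSpace

/-- **One line class.** `ν` unit, `1 ≤ R ≤ ρ`, `(Ea, Eb, W)` a frame with `‖Ea‖, ‖Eb‖ ≤ 1`,
`‖W‖ = 1`, `det² = 1/2`, `S ⊆ ℤ³` a chart image and `d` a coordinate: if every line `(a, b) + ℤW`
with an integer point in the slab sample is the `d`-shadow of a site of `S`, then
`√2 |⟪W,ν⟫| π ρ² − 10 √2 π ρ ≤ #π_d(S)`. -/
theorem lineClass_le_card_dropCoord (ν : EuclideanSpace ℝ (Fin 3)) (hν : ‖ν‖ = 1) (R ρ : ℝ)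
    (hR : 1 ≤ R) (hρ : R ≤ ρ) (Ea Eb W : EuclideanSpace ℝ (Fin 3)) (hEa : ‖Ea‖ ≤ 1)
    (hEb : ‖Eb‖ ≤ 1) (hW : ‖W‖ = 1)
    (hdet : (Matrix.det ![WithLp.ofLp Ea, WithLp.ofLp Eb, WithLp.ofLp W]) ^ 2 = 1 / 2)
    (S : Finset (Site 3)) (d : Fin 3)
    (hS : ∀ a b t : ℤ,
      -(2 * R) ≤ ⟪(a : ℝ) • Ea + (b : ℝ) • Eb + (t : ℝ) • W, ν⟫_ℝ →
      ⟪(a : ℝ) • Ea + (b : ℝ) • Eb + (t : ℝ) • W, ν⟫_ℝ ≤ -R →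
      ‖(a : ℝ) • Ea + (b : ℝ) • Eb + (t : ℝ) • W‖ ^ 2 -
          ⟪(a : ℝ) • Ea + (b : ℝ) • Eb + (t : ℝ) • W, ν⟫_ℝ ^ 2 ≤ ρ ^ 2 →
      ∃ s ∈ S, Fin.removeNth d s = ![a, b]) :
    Real.sqrt 2 * |⟪W, ν⟫_ℝ| * Real.pi * ρ ^ 2 - 10 * Real.sqrt 2 * Real.pi * ρ ≤
      ((dropCoord d S).card : ℝ) := by
  classical
  set e : Site 2 → ℤ × ℤ := fun w => (w 0, w 1) with he
  have heinj : Function.Injective e := by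
    intro w w' h
    simp only [he, Prod.mk.injEq] at h
    ext l; fin_cases l
    · exact h.1
    · exact h.2
  have hcard : ((dropCoord d S).image e).card = (dropCoord d S).card :=
    card_image_of_injective _ heinj
  have h := sqrt_two_mul_abs_inner_mul_pi_mul_sq_le_card ν hν R ρ hR hρ Ea Eb W hEa hEb hW hdet
    ((dropCoord d S).image e) ?_
  · rw [hcard] at h; exact h
  · intro a b t h1 h2 h3
    obtain ⟨s, hs, hsd⟩ := hS a b t h1 h2 h3
    rw [Finset.mem_image]
    refine ⟨Fin.removeNth d s, mem_dropCoord_iff.2 ⟨s, hs, rfl⟩, ?_⟩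
    rw [hsd, he]
    simp

/-- `u − v`, `u − t`, `v − t` as single sites. -/
theorem fcc_bond_differences :
    barlowPos 1 (Real.sqrt (2 / 3)) constHagg 0 1 0 - barlowPos 1 (Real.sqrt (2 / 3)) constHagg 0 0 1 =
        barlowPos 1 (Real.sqrt (2 / 3)) constHagg 0 1 (-1) ∧
      barlowPos 1 (Real.sqrt (2 / 3)) constHagg 0 1 0 - barlowPos 1 (Real.sqrt (2 / 3)) constHagg 1 0 0 =
        barlowPos 1 (Real.sqrt (2 / 3)) constHagg (-1) 1 0 ∧
      barlowPos 1 (Real.sqrt (2 / 3)) constHagg 0 0 1 - barlowPos 1 (Real.sqrt (2 / 3)) constHagg 1 0 0 =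
        barlowPos 1 (Real.sqrt (2 / 3)) constHagg (-1) 0 1 := by
  refine ⟨?_, ?_, ?_⟩ <;> rw [barlowPos_fcc_sub] <;> norm_num

/-- Squared determinant of a unimodular fcc frame: `det² = 1/2` when the integer determinant of
the coordinate rows is `±1`. -/
theorem det_sq_barlowPos_fcc {k₁ i₁ j₁ k₂ i₂ j₂ k₃ i₃ j₃ : ℤ}
    (hD : (i₁ * (j₂ * k₃ - k₂ * j₃) - j₁ * (i₂ * k₃ - k₂ * i₃) + k₁ * (i₂ * j₃ - j₂ * i₃)) ^ 2 = 1) :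
    (Matrix.det ![WithLp.ofLp (barlowPos 1 (Real.sqrt (2 / 3)) constHagg k₁ i₁ j₁),
        WithLp.ofLp (barlowPos 1 (Real.sqrt (2 / 3)) constHagg k₂ i₂ j₂),
        WithLp.ofLp (barlowPos 1 (Real.sqrt (2 / 3)) constHagg k₃ i₃ j₃)]) ^ 2 = 1 / 2 := by
  have h2 : Real.sqrt 2 ^ 2 = 2 := Real.sq_sqrt (by norm_num)
  have hD' : ((i₁ * (j₂ * k₃ - k₂ * j₃) - j₁ * (i₂ * k₃ - k₂ * i₃) + k₁ * (i₂ * j₃ - j₂ * i₃) : ℤ) : ℝ) ^ 2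
      = 1 := by exact_mod_cast hD
  rw [det_barlowPos_fcc, mul_pow, hD', div_pow, h2]
  norm_num

/-- **`stub_sampleDeficit`** (registered stub of the line `adhesion`, crux `NoReconstructionGain`):
for every slab thickness `R ≥ 1` there is `C` (`= 60 √2 π`) such that for EVERY unit normal `ν`
and every `ρ ≥ R`, the slab sample `P = Λ₀ ∩ {−2R ≤ ⟪p,ν⟫ ≤ −R, ‖p‖² − ⟪p,ν⟫² ≤ ρ²}` has
contact deficiency `D(P) ≥ 2 φ(ν) π ρ² − C ρ`, `φ(ν) = (√2/4) ∑ᶠ_{w ∈ Λ₀, ‖w‖ = 1} |⟪w, ν⟫|`. -/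
theorem stub_sampleDeficit :
    ∀ R : ℝ, 1 ≤ R → ∃ C : ℝ, ∀ ν : EuclideanSpace ℝ (Fin 3), ‖ν‖ = 1 → ∀ ρ : ℝ, R ≤ ρ →
      ∀ P : Finset (EuclideanSpace ℝ (Fin 3)),
        (∀ p, p ∈ P ↔ (p ∈ fccStacking 1 (Real.sqrt (2 / 3)) ∧ -(2 * R) ≤ ⟪p, ν⟫_ℝ ∧
          ⟪p, ν⟫_ℝ ≤ -R ∧ ‖p‖ ^ 2 - ⟪p, ν⟫_ℝ ^ 2 ≤ ρ ^ 2)) →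
        2 * (Real.sqrt 2 / 4 * ∑ᶠ w ∈ {w ∈ fccStacking 1 (Real.sqrt (2 / 3)) | ‖w‖ = 1},
            |⟪w, ν⟫_ℝ|) * Real.pi * ρ ^ 2 - C * ρ ≤ contactDeficiency P := by
  classical
  intro R hR
  refine ⟨60 * Real.sqrt 2 * Real.pi, ?_⟩
  intro ν hν ρ hρ P hP
  -- enumerate the sample
  set N : ℕ := P.card with hN
  set x : Fin N → EuclideanSpace ℝ (Fin 3) := fun i => ((P.equivFin.symm i : P) : _) with hxdef
  have hxinj : Function.Injective x := fun i j h =>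
    P.equivFin.symm.injective (Subtype.ext h)
  have himage : univ.image x = P := by
    ext p
    simp only [mem_image, mem_univ, true_and]
    constructor
    · rintro ⟨i, rfl⟩
      exact (P.equivFin.symm i).2
    · intro hp
      exact ⟨P.equivFin ⟨p, hp⟩, by simp [hxdef]⟩
  have hxP : ∀ p ∈ P, ∃ i, x i = p := fun p hp => ⟨P.equivFin ⟨p, hp⟩, by simp [hxdef]⟩
  have hmem : ∀ i, x i ∈ fccStacking 1 (Real.sqrt (2 / 3)) := fun i =>
    ((hP _).1 (P.equivFin.symm i).2).1
  have hcoord : ∀ i, ∃ k p q : ℤ, x i = barlowPos 1 (Real.sqrt (2 / 3)) constHagg k p q :=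
    fun i => hmem i
  choose kf pf qf hc using hcoord
  have hpack : IsUnitPacking x := fun i j hij =>
    le_dist_of_mem_barlowStacking_ideal isHaggSeq_const one_pos fcc_height_sq (hmem i) (hmem j)
      (fun h => hij (hxinj h))
  -- (L1) run counting: the deficiency of `P` is at least the number of bond lines meeting it
  have hshadow := numContacts_add_sum_card_dropCoord_le x hpack kf pf qf hc
  set a₁ : Fin N → Site 3 := fun i => ![pf i, qf i + kf i, -kf i] with ha₁
  set a₂ : Fin N → Site 3 := fun i => ![kf i + pf i + qf i, pf i + qf i, -qf i] with ha₂
  have hD : contactDeficiency P = 6 * (N : ℝ) - (numContacts x : ℝ) := by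
    rw [← himage, contactDeficiency_image_eq x hxinj]
  rw [Fin.sum_univ_three, Fin.sum_univ_three] at hshadow
  have hreal : (numContacts x : ℝ) + ((dropCoord 0 (univ.image a₁)).card : ℝ) +
      ((dropCoord 1 (univ.image a₁)).card : ℝ) + ((dropCoord 2 (univ.image a₁)).card : ℝ) +
      ((dropCoord 0 (univ.image a₂)).card : ℝ) + ((dropCoord 1 (univ.image a₂)).card : ℝ) +
      ((dropCoord 2 (univ.image a₂)).card : ℝ) ≤ 6 * (N : ℝ) := by
    exact_mod_cast (show numContacts x + (dropCoord 0 (univ.image a₁)).card +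
      (dropCoord 1 (univ.image a₁)).card + (dropCoord 2 (univ.image a₁)).card +
      (dropCoord 0 (univ.image a₂)).card + (dropCoord 1 (univ.image a₂)).card +
      (dropCoord 2 (univ.image a₂)).card ≤ 6 * N by omega)
  -- a lattice site in the sample region is one of the `x i`, with matching coordinates
  have key : ∀ k i j : ℤ,
      -(2 * R) ≤ ⟪barlowPos 1 (Real.sqrt (2 / 3)) constHagg k i j, ν⟫_ℝ →
      ⟪barlowPos 1 (Real.sqrt (2 / 3)) constHagg k i j, ν⟫_ℝ ≤ -R →
      ‖barlowPos 1 (Real.sqrt (2 / 3)) constHagg k i j‖ ^ 2 -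
          ⟪barlowPos 1 (Real.sqrt (2 / 3)) constHagg k i j, ν⟫_ℝ ^ 2 ≤ ρ ^ 2 →
      ∃ i₀, kf i₀ = k ∧ pf i₀ = i ∧ qf i₀ = j := by
    intro k i j h1 h2 h3
    obtain ⟨i₀, hi₀⟩ := hxP _ ((hP _).2 ⟨barlowPos_mem _ _ _, h1, h2, h3⟩)
    rw [hc i₀] at hi₀
    have hh := barlowPos_fcc_injective hi₀
    simp only [Prod.mk.injEq] at hh
    exact ⟨i₀, hh.1, hh.2.1, hh.2.2⟩
  -- unit bond vectors
  have hu : ‖barlowPos 1 (Real.sqrt (2 / 3)) constHagg 0 1 0‖ = 1 :=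
    norm_barlowPos_fcc_eq_one (by norm_num)
  have hv : ‖barlowPos 1 (Real.sqrt (2 / 3)) constHagg 0 0 1‖ = 1 :=
    norm_barlowPos_fcc_eq_one (by norm_num)
  have ht : ‖barlowPos 1 (Real.sqrt (2 / 3)) constHagg 1 0 0‖ = 1 :=
    norm_barlowPos_fcc_eq_one (by norm_num)
  have hvt : ‖barlowPos 1 (Real.sqrt (2 / 3)) constHagg (-1) 0 1‖ = 1 :=
    norm_barlowPos_fcc_eq_one (by norm_num)
  have hut : ‖barlowPos 1 (Real.sqrt (2 / 3)) constHagg (-1) 1 0‖ = 1 :=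
    norm_barlowPos_fcc_eq_one (by norm_num)
  have huv : ‖barlowPos 1 (Real.sqrt (2 / 3)) constHagg 0 1 (-1)‖ = 1 :=
    norm_barlowPos_fcc_eq_one (by norm_num)
  have hs21 : Fin.succAbove (2 : Fin 3) 1 = 1 := by decide
  -- (L2)+(L3) the six line classes.  Chart 1, coordinate 0: `Ea = v`, `Eb = v − t`, `W = u`.
  have c10 := lineClass_le_card_dropCoord ν hν R ρ hR hρ
    (barlowPos 1 (Real.sqrt (2 / 3)) constHagg 0 0 1) (barlowPos 1 (Real.sqrt (2 / 3)) constHagg (-1) 0 1)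
    (barlowPos 1 (Real.sqrt (2 / 3)) constHagg 0 1 0) hv.le hvt.le hu (det_sq_barlowPos_fcc (by norm_num))
    (univ.image a₁) 0 (by
      intro a b t h1 h2 h3
      have hpt : barlowPos 1 (Real.sqrt (2 / 3)) constHagg (-b) t (a + b) =
          (a : ℝ) • barlowPos 1 (Real.sqrt (2 / 3)) constHagg 0 0 1 +
            (b : ℝ) • barlowPos 1 (Real.sqrt (2 / 3)) constHagg (-1) 0 1 +
            (t : ℝ) • barlowPos 1 (Real.sqrt (2 / 3)) constHagg 0 1 0 := by
        rw [barlowPos_fcc_linear 1 _ (-b) t (a + b), barlowPos_fcc_linear 1 _ (-1) 0 1]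
        push_cast; module
      rw [← hpt] at h1 h2 h3
      obtain ⟨i₀, hk, hp, hq⟩ := key _ _ _ h1 h2 h3
      refine ⟨a₁ i₀, mem_image_of_mem _ (mem_univ _), ?_⟩
      ext l; fin_cases l <;> simp [ha₁, Fin.removeNth, hk, hq])
  -- Chart 1, coordinate 1: `Ea = u`, `Eb = v − t`, `W = v`.
  have c11 := lineClass_le_card_dropCoord ν hν R ρ hR hρ
    (barlowPos 1 (Real.sqrt (2 / 3)) constHagg 0 1 0) (barlowPos 1 (Real.sqrt (2 / 3)) constHagg (-1) 0 1)
    (barlowPos 1 (Real.sqrt (2 / 3)) constHagg 0 0 1) hu.le hvt.le hv (det_sq_barlowPos_fcc (by norm_num))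
    (univ.image a₁) 1 (by
      intro a b t h1 h2 h3
      have hpt : barlowPos 1 (Real.sqrt (2 / 3)) constHagg (-b) a (b + t) =
          (a : ℝ) • barlowPos 1 (Real.sqrt (2 / 3)) constHagg 0 1 0 +
            (b : ℝ) • barlowPos 1 (Real.sqrt (2 / 3)) constHagg (-1) 0 1 +
            (t : ℝ) • barlowPos 1 (Real.sqrt (2 / 3)) constHagg 0 0 1 := by
        rw [barlowPos_fcc_linear 1 _ (-b) a (b + t), barlowPos_fcc_linear 1 _ (-1) 0 1]
        push_cast; module
      rw [← hpt] at h1 h2 h3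
      obtain ⟨i₀, hk, hp, hq⟩ := key _ _ _ h1 h2 h3
      refine ⟨a₁ i₀, mem_image_of_mem _ (mem_univ _), ?_⟩
      ext l; fin_cases l <;> simp [ha₁, Fin.removeNth, hk, hp])
  -- Chart 1, coordinate 2: `Ea = u`, `Eb = v`, `W = v − t`.
  have c12 := lineClass_le_card_dropCoord ν hν R ρ hR hρ
    (barlowPos 1 (Real.sqrt (2 / 3)) constHagg 0 1 0) (barlowPos 1 (Real.sqrt (2 / 3)) constHagg 0 0 1)
    (barlowPos 1 (Real.sqrt (2 / 3)) constHagg (-1) 0 1) hu.le hv.le hvt (det_sq_barlowPos_fcc (by norm_num))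
    (univ.image a₁) 2 (by
      intro a b t h1 h2 h3
      have hpt : barlowPos 1 (Real.sqrt (2 / 3)) constHagg (-t) a (b + t) =
          (a : ℝ) • barlowPos 1 (Real.sqrt (2 / 3)) constHagg 0 1 0 +
            (b : ℝ) • barlowPos 1 (Real.sqrt (2 / 3)) constHagg 0 0 1 +
            (t : ℝ) • barlowPos 1 (Real.sqrt (2 / 3)) constHagg (-1) 0 1 := by
        rw [barlowPos_fcc_linear 1 _ (-t) a (b + t), barlowPos_fcc_linear 1 _ (-1) 0 1]
        push_cast; module
      rw [← hpt] at h1 h2 h3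
      obtain ⟨i₀, hk, hp, hq⟩ := key _ _ _ h1 h2 h3
      refine ⟨a₁ i₀, mem_image_of_mem _ (mem_univ _), ?_⟩
      ext l; fin_cases l <;> simp [ha₁, Fin.removeNth, hk, hp, hq, hs21])
  -- Chart 2, coordinate 0: `Ea = u − t`, `Eb = u − v`, `W = t`.
  have c20 := lineClass_le_card_dropCoord ν hν R ρ hR hρ
    (barlowPos 1 (Real.sqrt (2 / 3)) constHagg (-1) 1 0) (barlowPos 1 (Real.sqrt (2 / 3)) constHagg 0 1 (-1))
    (barlowPos 1 (Real.sqrt (2 / 3)) constHagg 1 0 0) hut.le huv.le ht (det_sq_barlowPos_fcc (by norm_num))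
    (univ.image a₂) 0 (by
      intro a b t h1 h2 h3
      have hpt : barlowPos 1 (Real.sqrt (2 / 3)) constHagg (t - a) (a + b) (-b) =
          (a : ℝ) • barlowPos 1 (Real.sqrt (2 / 3)) constHagg (-1) 1 0 +
            (b : ℝ) • barlowPos 1 (Real.sqrt (2 / 3)) constHagg 0 1 (-1) +
            (t : ℝ) • barlowPos 1 (Real.sqrt (2 / 3)) constHagg 1 0 0 := by
        rw [barlowPos_fcc_linear 1 _ (t - a) (a + b) (-b), barlowPos_fcc_linear 1 _ (-1) 1 0,
          barlowPos_fcc_linear 1 _ 0 1 (-1)]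
        push_cast; module
      rw [← hpt] at h1 h2 h3
      obtain ⟨i₀, hk, hp, hq⟩ := key _ _ _ h1 h2 h3
      refine ⟨a₂ i₀, mem_image_of_mem _ (mem_univ _), ?_⟩
      ext l; fin_cases l <;> simp [ha₂, Fin.removeNth, hp, hq])
  -- Chart 2, coordinate 1: `Ea = t`, `Eb = u − v`, `W = u − t`.
  have c21 := lineClass_le_card_dropCoord ν hν R ρ hR hρ
    (barlowPos 1 (Real.sqrt (2 / 3)) constHagg 1 0 0) (barlowPos 1 (Real.sqrt (2 / 3)) constHagg 0 1 (-1))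
    (barlowPos 1 (Real.sqrt (2 / 3)) constHagg (-1) 1 0) ht.le huv.le hut (det_sq_barlowPos_fcc (by norm_num))
    (univ.image a₂) 1 (by
      intro a b t h1 h2 h3
      have hpt : barlowPos 1 (Real.sqrt (2 / 3)) constHagg (a - t) (b + t) (-b) =
          (a : ℝ) • barlowPos 1 (Real.sqrt (2 / 3)) constHagg 1 0 0 +
            (b : ℝ) • barlowPos 1 (Real.sqrt (2 / 3)) constHagg 0 1 (-1) +
            (t : ℝ) • barlowPos 1 (Real.sqrt (2 / 3)) constHagg (-1) 1 0 := by
        rw [barlowPos_fcc_linear 1 _ (a - t) (b + t) (-b), barlowPos_fcc_linear 1 _ (-1) 1 0,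
          barlowPos_fcc_linear 1 _ 0 1 (-1)]
        push_cast; module
      rw [← hpt] at h1 h2 h3
      obtain ⟨i₀, hk, hp, hq⟩ := key _ _ _ h1 h2 h3
      refine ⟨a₂ i₀, mem_image_of_mem _ (mem_univ _), ?_⟩
      ext l; fin_cases l <;> simp [ha₂, Fin.removeNth, hk, hp, hq])
  -- Chart 2, coordinate 2: `Ea = t`, `Eb = u − t`, `W = u − v`.
  have c22 := lineClass_le_card_dropCoord ν hν R ρ hR hρ
    (barlowPos 1 (Real.sqrt (2 / 3)) constHagg 1 0 0) (barlowPos 1 (Real.sqrt (2 / 3)) constHagg (-1) 1 0)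
    (barlowPos 1 (Real.sqrt (2 / 3)) constHagg 0 1 (-1)) ht.le hut.le huv (det_sq_barlowPos_fcc (by norm_num))
    (univ.image a₂) 2 (by
      intro a b t h1 h2 h3
      have hpt : barlowPos 1 (Real.sqrt (2 / 3)) constHagg (a - b) (b + t) (-t) =
          (a : ℝ) • barlowPos 1 (Real.sqrt (2 / 3)) constHagg 1 0 0 +
            (b : ℝ) • barlowPos 1 (Real.sqrt (2 / 3)) constHagg (-1) 1 0 +
            (t : ℝ) • barlowPos 1 (Real.sqrt (2 / 3)) constHagg 0 1 (-1) := by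
        rw [barlowPos_fcc_linear 1 _ (a - b) (b + t) (-t), barlowPos_fcc_linear 1 _ (-1) 1 0,
          barlowPos_fcc_linear 1 _ 0 1 (-1)]
        push_cast; module
      rw [← hpt] at h1 h2 h3
      obtain ⟨i₀, hk, hp, hq⟩ := key _ _ _ h1 h2 h3
      refine ⟨a₂ i₀, mem_image_of_mem _ (mem_univ _), ?_⟩
      ext l; fin_cases l <;> simp [ha₂, Fin.removeNth, hk, hp, hq, hs21]
      ring)
  -- (L4) the six classes add up to `2 φ(ν)`
  obtain ⟨euv, eut, evt⟩ := fcc_bond_differences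
  rw [finsum_fccShell_abs_inner ν, euv, eut, evt]
  rw [hD]
  have hπ : 0 ≤ Real.sqrt 2 * Real.pi * ρ := by
    have : 0 ≤ ρ := by linarith
    positivity
  nlinarith [c10, c11, c12, c20, c21, c22, hreal, abs_nonneg ⟪barlowPos 1 (Real.sqrt (2 / 3)) constHagg 0 1 0, ν⟫_ℝ]

end Summit.Ventures.Crystal3D.Theorems

end
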